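import Mathlib
import Summits.Ventures.PercRepro2.Defs
import Summits.Ventures.PercRepro2.Graph
import Summits.Ventures.PercRepro2.OneColourSwitch
import Summits.Ventures.PercRepro2.RegionHubSign
import Summits.Ventures.PercRepro2.SideSwitch
import Summits.Ventures.PercRepro2.TermSwitchDefs
import Summits.Ventures.PercRepro2.TermSwitchFibre
import Summits.Ventures.PercRepro2.TermSwitchMono
import Summits.Ventures.PercRepro2.TermSwitchM9
import Summits.Ventures.PercRepro2.TermSwitchRestrict
import Summits.Ventures.PercRepro2.M9NoPocketDefs
import Summits.Ventures.PercRepro2.M9Unreached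

/-!
# The general single-`d` statement when `d` has a single rooted neighbour (blind cell
PercRepro2, p3 g25, 2026-08-28; `proofs/P3-GENERALD.md` §7(b))

A vertex is ROOTED if it is joined to `r` or `s` by a path avoiding `d` (a path of `G − d` with
every edge open: `Conn (endsD ends d) (fun _ => true)`).  If all rooted neighbours of the
non-mark `d` are one vertex `x ∉ {r, s}` (multi-edges allowed; the other neighbours of `d` lie in
components of `G − d` without `r, s`, and may be joined to `p, q`), then `d` is never doubly
reached in a `Sep ∧ DOne` colouring: a `Y`-edge and a `W`-edge of `d` into the worlds of
`{r, s}` in `G − d` both end at `x`, which would then be doubly reached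
(`not_both_of_singleRoot`).  Hence the single-`d` family splits into the unreached part
(`M9Unreached`) and the `Sep ∧ DZero` colourings with `d` reached — the restricted
`{r, s}`-terminal sum with the fibre-invariant predicate «`d ∉ O_H`» — and
`dSignSum ≤ 0` (`dSignSum_nonpos_of_singleRoot`): a class of the general statement beyond
`NoPocket` (pockets are arbitrary) and Conjecture G (no edge `d–r`, `d–s`).  Own work; std
axioms.
-/

namespace Summit.Ventures.PercRepro2

namespace NoPocket

open Finset Classical RegionHub OneColourSwitch SideSwitch TermSwitch

variable {V : Type*} {E : Type*}

section Root

variable {ends : E → Sym2 V} {r s d : V}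

/-- `d ∈ K₂` forces an open edge from `d` into the `Y`-world of `{r, s}` in `G − d`: otherwise
that world is closed under open adjacency in `G` and contains `r, s`, so it would contain `d`. -/
lemma exists_open_edge_of_mem_K2 (hr : d ≠ r) (hs : d ≠ s) {ω : Config E}
    (hd : d ∈ K2 ends r s ω) :
    ∃ e y, ends e = s(d, y) ∧ ω e = true ∧ y ∈ K2 (endsD ends d) r s ω := by
  by_contra hcon
  simp only [not_exists, not_and] at hcon
  have hclosed : ∀ x ∈ K2 (endsD ends d) r s ω, ∀ z, (openGraph ends ω).Adj x z →
      z ∈ K2 (endsD ends d) r s ω := by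
    intro x hx z hxz
    obtain ⟨hne, e, he, hends⟩ := openGraph_adj.1 hxz
    by_cases hzd : z = d
    · subst hzd
      exact (hcon e x (by rw [hends, Sym2.eq_swap]) he hx).elim
    · have hxd : x ≠ d := by
        rintro rfl
        exact not_mem_K2_endsD hr hs ω hx
      have hnot : d ∉ ends e := notMem_of_ends_ne hends hxd hzd
      have hadj : OpenAdj (endsD ends d) ω x z := ⟨e, he, by rw [endsD_of_notMem hnot]; exact hends⟩
      rw [mem_K2_iff] at hx ⊢
      rcases hx with hx | hx
      · exact Or.inl (conn_trans hx (conn_of_openAdj hadj))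
      · exact Or.inr (conn_trans hx (conn_of_openAdj hadj))
  rw [mem_K2_iff] at hd
  rcases hd with hd | hd
  · exact not_mem_K2_endsD hr hs ω (mem_of_conn_of_closed hclosed
      (mem_K2_iff.2 (Or.inl (conn_refl _ _ _))) hd)
  · exact not_mem_K2_endsD hr hs ω (mem_of_conn_of_closed hclosed
      (mem_K2_iff.2 (Or.inr (conn_refl _ _ _))) hd)

/-- The `W`-mirror: `d ∈ M₂` forces a closed edge from `d` into the `W`-world of `{r, s}` in
`G − d`. -/
lemma exists_closed_edge_of_mem_M2 (hr : d ≠ r) (hs : d ≠ s) {ω : Config E}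
    (hd : d ∈ M2 ends r s ω) :
    ∃ e y, ends e = s(d, y) ∧ ω e = false ∧ y ∈ M2 (endsD ends d) r s ω := by
  have hd' : d ∈ K2 ends r s (OneColourSwitch.compl ω) := by rw [K2_compl]; exact hd
  obtain ⟨e, y, hends, he, hy⟩ := exists_open_edge_of_mem_K2 hr hs hd'
  refine ⟨e, y, hends, ?_, hy⟩
  simpa [OneColourSwitch.compl] using he

/-- A vertex of the `Y`-world of `{r, s}` in `G − d` is rooted. -/
lemma rooted_of_mem_K2_endsD {ω : Config E} {y : V} (hy : y ∈ K2 (endsD ends d) r s ω) :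
    Conn (endsD ends d) (fun _ => true) y r ∨ Conn (endsD ends d) (fun _ => true) y s := by
  have hle : ω ≤ fun _ => true := fun e => by simp
  rw [mem_K2_iff] at hy
  rcases hy with hy | hy
  · exact Or.inl (conn_symm (conn_mono hle hy))
  · exact Or.inr (conn_symm (conn_mono hle hy))

/-- A vertex of the `W`-world of `{r, s}` in `G − d` is rooted. -/
lemma rooted_of_mem_M2_endsD {ω : Config E} {y : V} (hy : y ∈ M2 (endsD ends d) r s ω) :
    Conn (endsD ends d) (fun _ => true) y r ∨ Conn (endsD ends d) (fun _ => true) y s :=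
  rooted_of_mem_K2_endsD (ω := OneColourSwitch.compl ω) hy

/-- The worlds of `G − d` lie in the worlds of `G`. -/
lemma mem_K2_of_mem_K2_endsD {ω : Config E} {y : V} (hy : y ∈ K2 (endsD ends d) r s ω) :
    y ∈ K2 ends r s ω := by
  rw [mem_K2_iff] at hy ⊢
  rcases hy with hy | hy
  · exact Or.inl (conn_of_conn_endsD hy)
  · exact Or.inr (conn_of_conn_endsD hy)

/-- The `W`-worlds of `G − d` lie in the `W`-world of `G`. -/
lemma mem_M2_of_mem_M2_endsD {ω : Config E} {y : V} (hy : y ∈ M2 (endsD ends d) r s ω) :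
    y ∈ M2 ends r s ω :=
  mem_K2_of_mem_K2_endsD (ω := OneColourSwitch.compl ω) hy

/-- **The single-root hypothesis**: every rooted neighbour of `d` is the vertex `x`. -/
def SingleRoot (ends : E → Sym2 V) (r s d x : V) : Prop :=
  ∀ e y, ends e = s(d, y) → y ≠ d →
    (Conn (endsD ends d) (fun _ => true) y r ∨ Conn (endsD ends d) (fun _ => true) y s) → y = x

/-- Under the single-root hypothesis with `x ∉ {r, s}`, a `DOne` colouring never has `d` in both
worlds: the two edges of `d` into the worlds of `G − d` both end at `x`, which is then doubly
reached. -/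
lemma not_both_of_singleRoot {x : V} (hr : d ≠ r) (hs : d ≠ s) (hxr : x ≠ r) (hxs : x ≠ s)
    (hx : SingleRoot ends r s d x) {ω : Config E} (hD : DOne ends r s d ω) :
    ¬ (d ∈ K2 ends r s ω ∧ d ∈ M2 ends r s ω) := by
  rintro ⟨hK, hM⟩
  obtain ⟨e, y, hends, _, hy⟩ := exists_open_edge_of_mem_K2 hr hs hK
  obtain ⟨e', y', hends', _, hy'⟩ := exists_closed_edge_of_mem_M2 hr hs hM
  have hyd : y ≠ d := by
    rintro rfl
    exact not_mem_K2_endsD hr hs ω hy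
  have hyd' : y' ≠ d := by
    rintro rfl
    exact not_mem_K2_endsD hr hs (OneColourSwitch.compl ω) hy'
  have h1 : y = x := hx e y hends hyd (rooted_of_mem_K2_endsD hy)
  have h2 : y' = x := hx e' y' hends' hyd' (rooted_of_mem_M2_endsD hy')
  rw [h1] at hy hyd
  rw [h2] at hy'
  exact hD x hxr hxs hyd (mem_K2_of_mem_K2_endsD hy) (mem_M2_of_mem_M2_endsD hy')

end Root

section Sum

variable [Fintype V] [DecidableEq V] [Fintype E] [DecidableEq E] {ends : E → Sym2 V}
  {p q r s d : V}

omit [Fintype V] [DecidableEq V] [Fintype E] [DecidableEq E] in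
/-- `Sep ∧ DZero` with `d` reached is `Sep_H ∧ DZero_H ∧ d ∉ O_H` for `H = {r, s}`. -/
lemma reached_dzero_iff (ω : Config E) :
    (sep2 ends p q r s ω ∧ DZero ends r s ω ∧ (d ∈ K2 ends r s ω ∨ d ∈ M2 ends r s ω)) ↔
      (sepH ends p q ({r, s} : Set V) ω ∧ DZeroH ends ({r, s} : Set V) ω ∧
        d ∉ OsetH ends ({r, s} : Set V) ω) := by
  constructor
  · rintro ⟨⟨⟨hpr, hps, hqr, hqs⟩, ⟨hpr', hps', hqr', hqs'⟩⟩, hD, hR⟩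
    refine ⟨⟨?_, ?_, ?_, ?_⟩, ?_, ?_⟩
    · rintro ⟨h, hh, hc⟩
      simp only [Set.mem_insert_iff, Set.mem_singleton_iff] at hh
      rcases hh with rfl | rfl
      · exact hpr (conn_symm hc)
      · exact hps (conn_symm hc)
    · rintro ⟨h, hh, hc⟩
      simp only [Set.mem_insert_iff, Set.mem_singleton_iff] at hh
      rcases hh with rfl | rfl
      · exact hqr (conn_symm hc)
      · exact hqs (conn_symm hc)
    · rintro ⟨h, hh, hc⟩
      simp only [Set.mem_insert_iff, Set.mem_singleton_iff] at hh
      rcases hh with rfl | rfl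
      · exact hpr' (conn_symm hc)
      · exact hps' (conn_symm hc)
    · rintro ⟨h, hh, hc⟩
      simp only [Set.mem_insert_iff, Set.mem_singleton_iff] at hh
      rcases hh with rfl | rfl
      · exact hqr' (conn_symm hc)
      · exact hqs' (conn_symm hc)
    · intro x hxH hxK hxM
      have hxr : x ≠ r := fun h => hxH (by rw [h]; simp)
      have hxs : x ≠ s := fun h => hxH (by rw [h]; simp)
      exact hD x hxr hxs hxK hxM
    · intro hO
      exact hO hR
  · rintro ⟨hsep, hD, hO⟩
    refine ⟨sep2_of_sepH (by simp) (by simp) hsep, ?_, ?_⟩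
    · intro x hxr hxs hxK
      have hxH : x ∉ ({r, s} : Set V) := by
        simp only [Set.mem_insert_iff, Set.mem_singleton_iff, not_or]
        exact ⟨hxr, hxs⟩
      exact not_mem_both_of_DZeroH (by simp) (by simp) hD hxH hxK
    · by_contra h
      exact hO (fun h' => h h')

/-- The reached `Sep ∧ DZero` part of the single-`d` family: `Σ_{Sep ∧ DZero, d ∈ K₂ ∪ M₂}`. -/
noncomputable def reachedDZeroSum (ends : E → Sym2 V) (p q r s d : V) : ℤ :=
  ∑ ω : Config E, if sep2 ends p q r s ω ∧ DZero ends r s ω ∧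
      (d ∈ K2 ends r s ω ∨ d ∈ M2 ends r s ω) then sigma ends ω p q * sigma ends ω r s else 0

/-- **The reached `DZero` part is non-positive**: the restricted `{r, s}`-terminal theorem with the
fibre-invariant predicate «`d ∉ O_H`». -/
theorem reachedDZeroSum_nonpos : reachedDZeroSum ends p q r s d ≤ 0 := by
  have h : reachedDZeroSum ends p q r s d = dzeroSignSumHP ends p q r s ({r, s} : Set V)
      (fun ω => d ∉ OsetH ends ({r, s} : Set V) ω) := by
    unfold reachedDZeroSum dzeroSignSumHP
    refine Finset.sum_congr rfl fun ω _ => ?_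
    by_cases hc : sep2 ends p q r s ω ∧ DZero ends r s ω ∧
        (d ∈ K2 ends r s ω ∨ d ∈ M2 ends r s ω)
    · rw [if_pos hc, if_pos ((reached_dzero_iff ω).1 hc)]
    · rw [if_neg hc, if_neg (fun h => hc ((reached_dzero_iff ω).2 h))]
  rw [h]
  refine dzeroSignSumHP_nonpos p q s (by simp) _ ?_ ?_
  · intro ρ _ T hT
    rw [OsetH_assignC hT]
  · intro ρ _
    simp only [flipOH]
    rw [OsetH_flipIn]

omit [Fintype V] [DecidableEq V] in
/-- **The single-`d` sum without doubly reached `d`** is the unreached part plus the reached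
`DZero` part. -/
theorem dSignSum_eq_unreached_add_reached (hnot : ∀ ω : Config E, DOne ends r s d ω →
    ¬ (d ∈ K2 ends r s ω ∧ d ∈ M2 ends r s ω)) :
    dSignSum ends p q r s d = unreachedSum ends p q r s d + reachedDZeroSum ends p q r s d := by
  unfold dSignSum unreachedSum reachedDZeroSum
  rw [← Finset.sum_add_distrib]
  refine Finset.sum_congr rfl fun ω _ => ?_
  by_cases h0 : sep2 ends p q r s ω ∧ DOne ends r s d ω
  · rw [if_pos h0]
    by_cases hR : d ∈ K2 ends r s ω ∨ d ∈ M2 ends r s ω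
    · have hN : ¬ (sep2 ends p q r s ω ∧ DOne ends r s d ω ∧ d ∉ K2 ends r s ω ∧
          d ∉ M2 ends r s ω) := by
        rintro ⟨_, _, hK, hM⟩
        rcases hR with h | h
        · exact hK h
        · exact hM h
      have hDZ : DZero ends r s ω := by
        intro x hxr hxs hxK hxM
        by_cases hxd : x = d
        · subst hxd
          exact hnot ω h0.2 ⟨hxK, hxM⟩
        · exact h0.2 x hxr hxs hxd hxK hxM
      rw [if_neg hN, if_pos ⟨h0.1, hDZ, hR⟩, zero_add]
    · have hN : sep2 ends p q r s ω ∧ DOne ends r s d ω ∧ d ∉ K2 ends r s ω ∧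
          d ∉ M2 ends r s ω :=
        ⟨h0.1, h0.2, fun h => hR (Or.inl h), fun h => hR (Or.inr h)⟩
      rw [if_pos hN, if_neg (fun h => hR h.2.2), add_zero]
  · rw [if_neg h0, if_neg (fun h => h0 ⟨h.1, h.2.1⟩), if_neg (fun h => h0 ⟨h.1, ?_⟩)]
    · simp
    · intro x hxr hxs _ hxK
      exact h.2.1 x hxr hxs hxK

/-- **The general single-`d` statement for a vertex with a single rooted neighbour**:
`dSignSum ≤ 0` whenever every neighbour of `d` joined to `{r, s}` by a path avoiding `d` is one
vertex `x ∉ {r, s}`. -/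
theorem dSignSum_nonpos_of_singleRoot {x : V} (hr : d ≠ r) (hs : d ≠ s) (hxr : x ≠ r)
    (hxs : x ≠ s) (hx : SingleRoot ends r s d x) : dSignSum ends p q r s d ≤ 0 := by
  rw [dSignSum_eq_unreached_add_reached (fun ω hD => not_both_of_singleRoot hr hs hxr hxs hx hD)]
  have h1 := unreachedSum_nonpos (ends := ends) (p := p) (q := q) (r := r) (s := s) (d := d)
  have h2 := reachedDZeroSum_nonpos (ends := ends) (p := p) (q := q) (r := r) (s := s) (d := d)
  linarith

end Sum

end NoPocket

end Summit.Ventures.PercRepro2
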